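import Literature.MathematicalPhysics.KineticTheory.HardSphereCampbellFormulaHolds
import Literature.MathematicalPhysics.KineticTheory.HardSphereEulerProofs
import Summits.AtomisticToContinuum.HydrodynamicLimit.Theorems.JParityClosureOddContactSymmetryGibbsInvariance
import HarnessLib

/-!
# Campbell's formula under the invariant homogeneous Gibbs law (line `KineticSlabSketch`, piece P2 of S1a)

Crux `JParityClosure.OddContactSymmetry` (stmt-AtomisticToContinuum-17722, rev 5), line `KineticSlabSketch`, lead
`prover-line-stmt-AtomisticToContinuum-17722-c1-0` (cycle 2).  Piece P2 of the statics plan for the registered stub S1a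
`stub_slabCentring` (the `G_N`-mean of the Metropolis-odd slab sum): **the expected marked collision sum over a time window
under the flow-invariant homogeneous Gibbs law `G_N = localGibbsLaw σ a u θ N Φ` is `τ ×` the outgoing contact flux of the
mark weighted by the canonical Gibbs density** —

`∫ Σ_{s ∈ (0,τ]} Σ_{(i,j) in contact} g(Φ_s z, i, j) dG_N(z) = τ · outgoingCollisionFlux ε (N+1) (ρ_G · g)`

for every measurable `ℝ≥0∞`-valued configuration mark `g` (`lintegral_collisionPairSum_localGibbsLaw_const`).  It is the tree's
PROVED named fact `HardSphereCampbellFormula` (`hardSphereCampbellFormula_holds`, Cercignani–Illner–Pulvirenti 1994 App. 4.A) in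
its `withDensity` form, fed with the flow-invariance of the canonical density along good orbits
(`canonicalDensity_const_flow`, energy and hard-core conservation) and `localGibbsLaw = liouville.withDensity ρ_G`
(`particleLaw_eq`).  Valid for EVERY hard-sphere flow structure `Φ`, every `0 < σ < 1/2` (so `0 < ε = σ(N+1)^{-1/3} < 1/2`)
and all constant profile parameters `a, θ, u` (no sign needed: for `θ ≤ 0` both sides carry the same junk density).
-/

noncomputable section

open scoped BigOperators Classical InnerProductSpace ENNReal Topology
open Set MeasureTheory Filter
open Literature.Analysis.FluidPDE Literature.MathematicalPhysics.KineticTheory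

namespace Summit.AtomisticToContinuum.HydrodynamicLimit.Theorems.OddContactSymmetryKineticSlab

/-- **Campbell under the invariant homogeneous Gibbs law** (piece P2 of S1a): for `0 < σ < 1/2`, constant profiles
`(a, u, θ)`, every particle number, EVERY hard-sphere flow `Φ` on `𝕋³`, every measurable mark
`g : Config → Fin (N+1) → Fin (N+1) → ℝ≥0∞` and every `τ`,
`∫⁻ collisionPairSum (Ioc 0 τ) g dG_N = ofReal τ * outgoingCollisionFlux ε (N+1) (ofReal ρ_G · g)`, `ρ_G` the canonical
density of the constant local Gibbs profile.  [cite: CIP1994, App. 4.A pp. 107–111] -/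
theorem lintegral_collisionPairSum_localGibbsLaw_const :
    ∀ {σ : ℝ} (_hσ : 0 < σ) (_hσ2 : σ < 1 / 2) (a θ : ℝ) (u : V3) (N : ℕ)
    (Φ : HardSphereFlow (Torus.geometry (Fin 3)) (hsDiameter σ N) (N + 1))
    {g : Config (N + 1) (Fin 3) T3 → Fin (N + 1) → Fin (N + 1) → ℝ≥0∞}
    (_hg : ∀ i j, Measurable fun w => g w i j) (τ : ℝ),
    ∫⁻ z, Φ.collisionPairSum (Ioc 0 τ) (fun _ w i j => g w i j) z
        ∂(localGibbsLaw σ (fun _ => a) (fun _ => u) (fun _ => θ) N Φ) =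
      ENNReal.ofReal τ * outgoingCollisionFlux (hsDiameter σ N) (N + 1)
        (fun w i j => ENNReal.ofReal (canonicalDensity (Torus.geometry (Fin 3)) (hsDiameter σ N) (N + 1)
          (localGibbsProfile (fun _ => a) (fun _ => u) (fun _ => θ)) w) * g w i j) := by
  intro σ hσ hσ2 a θ u N Φ g hg τ
  have hε : 0 < hsDiameter σ N := hsDiameter_pos hσ N
  have hε' : hsDiameter σ N < 1 / 2 := (hsDiameter_le hσ.le N).trans_lt hσ2
  rw [localGibbsLaw, particleLaw_eq]
  refine hardSphereCampbellFormula_holds.withDensity hε hε' Φ ?_ (fun z => ENNReal.ofReal_ne_top) ?_ hg τ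
  · exact (measurable_canonicalDensity _ _
      (measurable_localGibbsProfile continuous_const continuous_const continuous_const)).ennreal_ofReal
  · intro z hz t
    simp only [canonicalDensity_const_flow a θ u Φ hz t]


/-- Pathwise: on the good set a REAL-valued collision pair sum over `(0, τ]` is the difference of the (finite) `ℝ≥0∞`
collision pair sums of the positive and negative parts of the mark. [folklore] -/
theorem collisionPairSum_real_eq_toReal_sub {σ : ℝ} {N : ℕ}
    (Φ : HardSphereFlow (Torus.geometry (Fin 3)) (hsDiameter σ N) (N + 1))
    {z : Config (N + 1) (Fin 3) T3} (hz : z ∈ Φ.good) (τ : ℝ)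
    (m : Config (N + 1) (Fin 3) T3 → Fin (N + 1) → Fin (N + 1) → ℝ) :
    Φ.collisionPairSum (Ioc 0 τ) (fun _ w i j => m w i j) z =
      (Φ.collisionPairSum (Ioc 0 τ) (fun _ w i j => ENNReal.ofReal (m w i j)) z).toReal -
        (Φ.collisionPairSum (Ioc 0 τ) (fun _ w i j => ENNReal.ofReal (-m w i j)) z).toReal := by
  have hfin := Φ.finite_collisionTimes_inter hz (S := Ioc 0 τ) Ioc_subset_Icc_self
  unfold HardSphereFlow.collisionPairSum
  rw [collisionPairSum_eq_finset_sum hfin, collisionPairSum_eq_finset_sum hfin,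
    collisionPairSum_eq_finset_sum hfin,
    ENNReal.toReal_sum (fun t _ => ENNReal.sum_ne_top.2 fun p _ => ENNReal.ofReal_ne_top),
    ENNReal.toReal_sum (fun t _ => ENNReal.sum_ne_top.2 fun p _ => ENNReal.ofReal_ne_top),
    ← Finset.sum_sub_distrib]
  refine Finset.sum_congr rfl fun t _ => ?_
  rw [ENNReal.toReal_sum (fun p _ => ENNReal.ofReal_ne_top), ENNReal.toReal_sum (fun p _ => ENNReal.ofReal_ne_top),
    ← Finset.sum_sub_distrib]
  refine Finset.sum_congr rfl fun p _ => ?_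
  rw [ENNReal.toReal_ofReal', ENNReal.toReal_ofReal']
  exact (max_zero_sub_max_neg_zero_eq_self _).symm

/-- **Signed Campbell under the invariant homogeneous Gibbs law** (piece P2 of S1a, real marks): for a measurable real
mark `m` whose absolute collision pair sum over `(0, τ]` has finite `G_N`-expectation,
`∫ collisionPairSum (Ioc 0 τ) m dG_N = (ofReal τ · flux(ρ_G m⁺)).toReal − (ofReal τ · flux(ρ_G m⁻)).toReal`.
[cite: CIP1994, App. 4.A pp. 107–111] -/
theorem integral_collisionPairSum_localGibbsLaw_const :
    ∀ {σ : ℝ} (_hσ : 0 < σ) (_hσ2 : σ < 1 / 2) (a θ : ℝ) (u : V3) (N : ℕ)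
    (Φ : HardSphereFlow (Torus.geometry (Fin 3)) (hsDiameter σ N) (N + 1))
    {m : Config (N + 1) (Fin 3) T3 → Fin (N + 1) → Fin (N + 1) → ℝ}
    (_hm : ∀ i j, Measurable fun w => m w i j) (τ : ℝ)
    (_hfin : ∫⁻ z, Φ.collisionPairSum (Ioc 0 τ) (fun _ w i j => ENNReal.ofReal |m w i j|) z
        ∂(localGibbsLaw σ (fun _ => a) (fun _ => u) (fun _ => θ) N Φ) ≠ ∞),
    ∫ z, Φ.collisionPairSum (Ioc 0 τ) (fun _ w i j => m w i j) z
        ∂(localGibbsLaw σ (fun _ => a) (fun _ => u) (fun _ => θ) N Φ) =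
      (ENNReal.ofReal τ * outgoingCollisionFlux (hsDiameter σ N) (N + 1)
        (fun w i j => ENNReal.ofReal (canonicalDensity (Torus.geometry (Fin 3)) (hsDiameter σ N) (N + 1)
          (localGibbsProfile (fun _ => a) (fun _ => u) (fun _ => θ)) w) * ENNReal.ofReal (m w i j))).toReal -
      (ENNReal.ofReal τ * outgoingCollisionFlux (hsDiameter σ N) (N + 1)
        (fun w i j => ENNReal.ofReal (canonicalDensity (Torus.geometry (Fin 3)) (hsDiameter σ N) (N + 1)
          (localGibbsProfile (fun _ => a) (fun _ => u) (fun _ => θ)) w) * ENNReal.ofReal (-m w i j))).toReal := by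
  intro σ hσ hσ2 a θ u N Φ m hm τ hfin
  have hε : 0 < hsDiameter σ N := hsDiameter_pos hσ N
  have hε' : hsDiameter σ N < 1 / 2 := (hsDiameter_le hσ.le N).trans_lt hσ2
  set G := localGibbsLaw σ (fun _ => a) (fun _ => u) (fun _ => θ) N Φ with hG
  have hac : G ≪ liouville (Torus.geometry (Fin 3)) (N + 1) (hsDiameter σ N) := by
    rw [hG, localGibbsLaw, particleLaw_eq]; exact withDensity_absolutelyContinuous _ _
  have hgood : ∀ᵐ z ∂G, z ∈ Φ.good := hac Φ.ae_mem_good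
  set P : Config (N + 1) (Fin 3) T3 → ℝ≥0∞ := fun z =>
    Φ.collisionPairSum (Ioc 0 τ) (fun _ w i j => ENNReal.ofReal (m w i j)) z with hP
  set Q : Config (N + 1) (Fin 3) T3 → ℝ≥0∞ := fun z =>
    Φ.collisionPairSum (Ioc 0 τ) (fun _ w i j => ENNReal.ofReal (-m w i j)) z with hQ
  set A : Config (N + 1) (Fin 3) T3 → ℝ≥0∞ := fun z =>
    Φ.collisionPairSum (Ioc 0 τ) (fun _ w i j => ENNReal.ofReal |m w i j|) z with hA
  have hmP : ∀ i j, Measurable fun w => ENNReal.ofReal (m w i j) := fun i j => (hm i j).ennreal_ofReal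
  have hmQ : ∀ i j, Measurable fun w => ENNReal.ofReal (-m w i j) := fun i j => (hm i j).neg.ennreal_ofReal
  have hPm : AEMeasurable P G := (aemeasurable_collisionPairSum hε hε' Φ _ hmP τ).mono_ac hac
  have hQm : AEMeasurable Q G := (aemeasurable_collisionPairSum hε hε' Φ _ hmQ τ).mono_ac hac
  -- termwise domination on the good set
  have hdom : ∀ (f : ℝ → ℝ), (∀ x, f x ≤ |x|) → ∀ z ∈ Φ.good,
      Φ.collisionPairSum (Ioc 0 τ) (fun _ w i j => ENNReal.ofReal (f (m w i j))) z ≤ A z := by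
    intro f hf z hz
    have hfin' := Φ.finite_collisionTimes_inter hz (S := Ioc 0 τ) Ioc_subset_Icc_self
    simp only [hA]
    unfold HardSphereFlow.collisionPairSum
    rw [collisionPairSum_eq_finset_sum hfin', collisionPairSum_eq_finset_sum hfin']
    exact Finset.sum_le_sum fun t _ => Finset.sum_le_sum fun p _ => ENNReal.ofReal_le_ofReal (hf _)
  have hPfin : ∫⁻ z, P z ∂G ≠ ∞ := by
    refine ne_top_of_le_ne_top hfin (lintegral_mono_ae ?_)
    filter_upwards [hgood] with z hz
    exact hdom (fun x => x) (fun x => le_abs_self x) z hz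
  have hQfin : ∫⁻ z, Q z ∂G ≠ ∞ := by
    refine ne_top_of_le_ne_top hfin (lintegral_mono_ae ?_)
    filter_upwards [hgood] with z hz
    exact hdom (fun x => -x) (fun x => neg_le_abs x) z hz
  have hPi : Integrable (fun z => (P z).toReal) G := integrable_toReal_of_lintegral_ne_top hPm hPfin
  have hQi : Integrable (fun z => (Q z).toReal) G := integrable_toReal_of_lintegral_ne_top hQm hQfin
  have hsplit : (fun z => Φ.collisionPairSum (Ioc 0 τ) (fun _ w i j => m w i j) z) =ᵐ[G]
      fun z => (P z).toReal - (Q z).toReal := by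
    filter_upwards [hgood] with z hz
    exact collisionPairSum_real_eq_toReal_sub Φ hz τ m
  rw [integral_congr_ae hsplit, integral_sub hPi hQi, integral_toReal hPm (ae_lt_top' hPm hPfin),
    integral_toReal hQm (ae_lt_top' hQm hQfin)]
  simp only [hP, hQ]
  rw [lintegral_collisionPairSum_localGibbsLaw_const hσ hσ2 a θ u N Φ hmP τ,
    lintegral_collisionPairSum_localGibbsLaw_const hσ hσ2 a θ u N Φ hmQ τ]

end Summit.AtomisticToContinuum.HydrodynamicLimit.Theorems.OddContactSymmetryKineticSlab

end
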